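import Mathlib
import Summits.PneNP.PneNP.Theorems.OverlapGapAlgebraSolvableImpliesStableSectionUnitClauseFMStep

/-!
# PneNP / OverlapGapAlgebra — crux `SolvableImpliesStableSection` (stmt-PneNP-2463):
# the UNIT CLAUSE block (8/·) — first moment of the number of unit clauses

Support for crux `stmt-PneNP-2463` (`Summit.PneNP.PneNP.Theses.OverlapGapAlgebra.SolvableImpliesStableSection`),
registered stub `stub_lowDensity` (child G).  Summing the one-clause step (`sissU_sum_unit_indicator_le`)
over the non-muted clauses gives the recursion behind the Chao–Franco threshold: with
`N^S_t(Φ)` the number of non-muted unit clauses at round `t`,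
`Σ_Φ N^S_{t+1} ≤ ((k²-k)·2^{1-k}·M / n) · Σ_{i ∉ S} (W·#Ω + Σ_Φ N^{S ∪ {i}}_t)`,
where `W = n/R + 1` bounds every label window, `M` bounds `u·s^{k-2}/n^{k-1}` (`u + s = n`), and the
variables set during a round are at most the window plus the unit clauses (`sissU_card_new_le`).  Hence,
uniformly in the muted set, `Σ_Φ N^S_t ≤ a·#Ω` for every `a ≥ 0` with
`(k²-k)·2^{1-k}·M·(m/n)·(W + a) ≤ a` — solvable iff `β = α(k²-k)2^{1-k}M < 1`, i.e. below the
unit-clause threshold.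

* `sissU_card_window_le`, `sissU_card_new_le`, `sissU_sum_unit_succ_le`, `sissU_sum_unit_le`.
All objects are hypotheses; no definitions; axioms `propext`, `Classical.choice`, `Quot.sound`.
-/

set_option linter.dupNamespace false -- `Summit.PneNP.PneNP.…`: summit = sub-problem (D-0017)

namespace Summit.PneNP.PneNP.Theorems

open Finset
open scoped Classical

section FirstMoment

variable {m k n : ℕ} {R : ℕ}

/-- **Label windows are small.** For `R ≥ 1` every window `{v : ⌊vR/n⌋ = t}` has at most `n/R + 1`
labels. -/
theorem sissU_card_window_le (hR : 1 ≤ R) (t : ℕ) :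
    ((univ : Finset (Fin n)).filter fun v : Fin n => (v : ℕ) * R / n = t).card ≤ n / R + 1 := by
  set V := (univ : Finset (Fin n)).filter fun v : Fin n => (v : ℕ) * R / n = t with hV
  rcases V.eq_empty_or_nonempty with hVe | hVne
  · rw [hVe, card_empty]; exact Nat.zero_le _
  have hn : 0 < n := by
    obtain ⟨v, -⟩ := hVne
    exact Fin.pos v
  have hmemV : ∀ v : Fin n, v ∈ V ↔ (v : ℕ) * R / n = t := fun v => by
    rw [hV, mem_filter]; exact ⟨fun h => h.2, fun h => ⟨mem_univ _, h⟩⟩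
  obtain ⟨v₀, hv₀mem, hv₀le⟩ : ∃ v₀ : Fin n, v₀ ∈ V ∧ ∀ v ∈ V, v₀ ≤ v :=
    ⟨V.min' hVne, min'_mem V hVne, fun v hv => min'_le V v hv⟩
  have hv₀t : (v₀ : ℕ) * R / n = t := (hmemV v₀).1 hv₀mem
  have h1 : t * n ≤ (v₀ : ℕ) * R := (Nat.le_div_iff_mul_le hn).mp (le_of_eq hv₀t.symm)
  -- every `v ∈ V` is `v₀ + d` with `d ≤ n / R`
  have hbound : ∀ v ∈ V, (v : ℕ) - (v₀ : ℕ) < n / R + 1 := by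
    intro v hv
    have hvt : (v : ℕ) * R / n = t := (hmemV v).1 hv
    have hle : (v₀ : ℕ) ≤ (v : ℕ) := hv₀le v hv
    have h2 : (v : ℕ) * R < (t + 1) * n :=
      (Nat.div_lt_iff_lt_mul hn).mp (by rw [hvt]; exact Nat.lt_succ_self t)
    rw [add_one_mul] at h2
    have h3 : ((v : ℕ) - (v₀ : ℕ)) * R < n := by
      rw [Nat.sub_mul]
      have := Nat.mul_le_mul_right R hle
      omega
    refine Nat.lt_succ_of_le ((Nat.le_div_iff_mul_le hR).mpr h3.le)
  calc V.card ≤ (range (n / R + 1)).card := by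
        refine card_le_card_of_injOn (fun v => (v : ℕ) - (v₀ : ℕ)) (fun v hv => ?_) ?_
        · rw [coe_range, Set.mem_Iio]
          exact hbound v hv
        · intro v hv v' hv' (h : (v : ℕ) - (v₀ : ℕ) = (v' : ℕ) - (v₀ : ℕ))
          have h1 := hv₀le v hv
          have h2 := hv₀le v' hv'
          rw [Fin.le_def] at h1 h2
          exact Fin.ext (by omega)
    _ = n / R + 1 := card_range _

/-- **Variables set during a round: the window plus the forced ones.** In the dynamics with muted set
`S'`, the variables unset at round `t` and set at round `t + 1` are at most the labels of window `t` plus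
the non-muted unit clauses at round `t` (a forced variable carries a unit clause, and a clause is unit on
at most one variable). -/
theorem sissU_card_new_le
    (st : Finset (Fin m) → ℕ → (Fin m → Fin k → Fin n × Bool) → Fin n → Option Bool)
    (dm : Finset (Fin m) → ℕ → (Fin m → Fin k → Fin n × Bool) → Fin n → Bool)
    (hstep : ∀ (S : Finset (Fin m)) (t : ℕ) (Φ : Fin m → Fin k → Fin n × Bool) (v : Fin n),
      st S (t + 1) Φ v =
        if st S t Φ v = none then
          (if ∃ i : Fin m, i ∉ S ∧ ∃ j : Fin k, (Φ i j).1 = v ∧ ∀ j' : Fin k, j' ≠ j →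
              st S t Φ (Φ i j').1 ≠ none ∧ st S t Φ (Φ i j').1 ≠ some (Φ i j').2
            then some (dm S t Φ v)
            else if (v : ℕ) * R / n = t then some true else none)
        else st S t Φ v)
    (S' : Finset (Fin m)) (t : ℕ) (Φ : Fin m → Fin k → Fin n × Bool) :
    ((univ : Finset (Fin n)).filter fun w => st S' t Φ w = none ∧ st S' (t + 1) Φ w ≠ none).card ≤
      ((univ : Finset (Fin n)).filter fun v : Fin n => (v : ℕ) * R / n = t).card +
      ((univ : Finset (Fin m)).filter fun i => i ∉ S' ∧ ∃ j : Fin k, st S' t Φ (Φ i j).1 = none ∧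
        ∀ j' : Fin k, j' ≠ j → st S' t Φ (Φ i j').1 ≠ none ∧ st S' t Φ (Φ i j').1 ≠ some (Φ i j').2).card := by
  -- split into free and forced
  set Forced := (univ : Finset (Fin n)).filter fun w => st S' t Φ w = none ∧
    ∃ i : Fin m, i ∉ S' ∧ ∃ j : Fin k, (Φ i j).1 = w ∧ ∀ j' : Fin k, j' ≠ j →
      st S' t Φ (Φ i j').1 ≠ none ∧ st S' t Φ (Φ i j').1 ≠ some (Φ i j').2 with hForced
  have hsub : ((univ : Finset (Fin n)).filter fun w => st S' t Φ w = none ∧ st S' (t + 1) Φ w ≠ none) ⊆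
      ((univ : Finset (Fin n)).filter fun v : Fin n => (v : ℕ) * R / n = t) ∪ Forced := by
    intro w hw
    rw [mem_filter] at hw
    rw [mem_union, mem_filter, hForced, mem_filter]
    rcases sissU_forced_or_free st dm hstep S' t Φ w hw.2.1 hw.2.2 with h | h
    · exact Or.inr ⟨mem_univ _, hw.2.1, h⟩
    · exact Or.inl ⟨mem_univ _, h⟩
  refine (card_le_card hsub).trans ((card_union_le _ _).trans (Nat.add_le_add_left ?_ _))
  -- forced variables are covered by the unit clauses, each unit on at most one variable
  have hcov : Forced ⊆ ((univ : Finset (Fin m)).filter fun i => i ∉ S' ∧ ∃ j : Fin k, st S' t Φ (Φ i j).1 = none ∧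
        ∀ j' : Fin k, j' ≠ j → st S' t Φ (Φ i j').1 ≠ none ∧ st S' t Φ (Φ i j').1 ≠ some (Φ i j').2).biUnion
      fun i => (univ : Finset (Fin n)).filter fun w => st S' t Φ w = none ∧ ∃ j : Fin k, (Φ i j).1 = w ∧
        ∀ j' : Fin k, j' ≠ j → st S' t Φ (Φ i j').1 ≠ none ∧ st S' t Φ (Φ i j').1 ≠ some (Φ i j').2 := by
    intro w hw
    rw [hForced, mem_filter] at hw
    obtain ⟨-, hw0, i, hiS, j, hj, hrest⟩ := hw
    rw [mem_biUnion]
    refine ⟨i, ?_, ?_⟩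
    · rw [mem_filter]
      exact ⟨mem_univ _, hiS, j, by rw [hj]; exact hw0, hrest⟩
    · rw [mem_filter]
      exact ⟨mem_univ _, hw0, j, hj, hrest⟩
  refine (card_le_card hcov).trans (card_biUnion_le.trans ?_)
  refine (sum_le_sum fun i _ => ?_).trans (by rw [sum_const, smul_eq_mul, mul_one])
  rw [card_le_one]
  intro w hw w' hw'
  rw [mem_filter] at hw hw'
  obtain ⟨-, hw0, j, hj, hrest⟩ := hw
  obtain ⟨-, hw0', j', hj', hrest'⟩ := hw'
  exact sissU_unit_var_unique st S' t Φ i w w' ⟨j, hj, hw0, hrest⟩ ⟨j', hj', hw0', hrest'⟩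

/-- **The summed first-moment recursion.** For every muted set `S` and round `t`:
`#contents · Σ_Φ N^S_{t+1}(Φ) ≤ (k²-k)·2·M·n^{k-1} · Σ_{i ∉ S} (W_t·#Ω + Σ_Φ N^{insert i S}_t(Φ))`, where
`N^S_t(Φ)` is the number of non-muted unit clauses at round `t`, `W_t` the size of label window `t`, and
`M` bounds `u·s^{k-2} ≤ M·n^{k-1}` for `u + s = n`. -/
theorem sissU_sum_unit_succ_le
    (st : Finset (Fin m) → ℕ → (Fin m → Fin k → Fin n × Bool) → Fin n → Option Bool)
    (dm : Finset (Fin m) → ℕ → (Fin m → Fin k → Fin n × Bool) → Fin n → Bool)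
    (h0 : ∀ (S : Finset (Fin m)) (Φ : Fin m → Fin k → Fin n × Bool) (v : Fin n), st S 0 Φ v = none)
    (hstep : ∀ (S : Finset (Fin m)) (t : ℕ) (Φ : Fin m → Fin k → Fin n × Bool) (v : Fin n),
      st S (t + 1) Φ v =
        if st S t Φ v = none then
          (if ∃ i : Fin m, i ∉ S ∧ ∃ j : Fin k, (Φ i j).1 = v ∧ ∀ j' : Fin k, j' ≠ j →
              st S t Φ (Φ i j').1 ≠ none ∧ st S t Φ (Φ i j').1 ≠ some (Φ i j').2
            then some (dm S t Φ v)
            else if (v : ℕ) * R / n = t then some true else none)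
        else st S t Φ v)
    (hdm : ∀ (S : Finset (Fin m)) (t : ℕ) (Φ : Fin m → Fin k → Fin n × Bool) (v : Fin n) (i : Fin m)
      (j : Fin k), i ∉ S → (Φ i j).1 = v → st S t Φ v = none →
      (∀ j' : Fin k, j' ≠ j → st S t Φ (Φ i j').1 ≠ none ∧ st S t Φ (Φ i j').1 ≠ some (Φ i j').2) →
      (∀ i' : Fin m, i' ∉ S → (∃ j₁ : Fin k, (Φ i' j₁).1 = v ∧ ∀ j' : Fin k, j' ≠ j₁ →
        st S t Φ (Φ i' j').1 ≠ none ∧ st S t Φ (Φ i' j').1 ≠ some (Φ i' j').2) → i ≤ i') →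
      dm S t Φ v = (Φ i j).2)
    (M : ℝ) (hM : ∀ u s : ℕ, u + s = n → (u : ℝ) * (s : ℝ) ^ (k - 2) ≤ M * (n : ℝ) ^ (k - 1))
    (S : Finset (Fin m)) (t : ℕ) :
    (Fintype.card (Fin k → Fin n × Bool) : ℝ) *
      ∑ Φ : Fin m → Fin k → Fin n × Bool,
        (((univ : Finset (Fin m)).filter fun i => i ∉ S ∧ ∃ j : Fin k, st S (t + 1) Φ (Φ i j).1 = none ∧
          ∀ j' : Fin k, j' ≠ j → st S (t + 1) Φ (Φ i j').1 ≠ none ∧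
            st S (t + 1) Φ (Φ i j').1 ≠ some (Φ i j').2).card : ℝ)
      ≤ ((k * k - k : ℕ) : ℝ) * (2 * M * (n : ℝ) ^ (k - 1)) *
        ∑ i ∈ (univ : Finset (Fin m)).filter (fun i => i ∉ S),
          ((((univ : Finset (Fin n)).filter fun v : Fin n => (v : ℕ) * R / n = t).card : ℝ) *
              Fintype.card (Fin m → Fin k → Fin n × Bool) +
            ∑ Φ : Fin m → Fin k → Fin n × Bool,
              (((univ : Finset (Fin m)).filter fun i' => i' ∉ insert i S ∧ ∃ j : Fin k,
                st (insert i S) t Φ (Φ i' j).1 = none ∧ ∀ j' : Fin k, j' ≠ j →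
                  st (insert i S) t Φ (Φ i' j').1 ≠ none ∧
                    st (insert i S) t Φ (Φ i' j').1 ≠ some (Φ i' j').2).card : ℝ)) := by
  -- write the count as a sum of indicators and exchange the sums
  have hcard : ∀ Φ : Fin m → Fin k → Fin n × Bool,
      (((univ : Finset (Fin m)).filter fun i => i ∉ S ∧ ∃ j : Fin k, st S (t + 1) Φ (Φ i j).1 = none ∧
          ∀ j' : Fin k, j' ≠ j → st S (t + 1) Φ (Φ i j').1 ≠ none ∧
            st S (t + 1) Φ (Φ i j').1 ≠ some (Φ i j').2).card : ℝ)
        = ∑ i ∈ (univ : Finset (Fin m)).filter (fun i => i ∉ S),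
            (if ∃ j : Fin k, st S (t + 1) Φ (Φ i j).1 = none ∧ ∀ j' : Fin k, j' ≠ j →
                st S (t + 1) Φ (Φ i j').1 ≠ none ∧ st S (t + 1) Φ (Φ i j').1 ≠ some (Φ i j').2
              then (1 : ℝ) else 0) := by
    intro Φ
    rw [sum_boole, filter_filter]
  simp_rw [hcard]
  rw [sum_comm, mul_sum, mul_sum]
  refine sum_le_sum fun i hi => ?_
  rw [mem_filter] at hi
  have hstep1 := sissU_sum_unit_indicator_le st dm h0 hstep hdm S t i hi.2
  refine hstep1.trans ?_
  -- bound each summand: `2·U·New·Set^{k-2} ≤ 2·M·n^{k-1}·(W_t + N)`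
  rw [mul_add, mul_sum]
  have hΩ : ∑ _Φ : Fin m → Fin k → Fin n × Bool,
      ((k * k - k : ℕ) : ℝ) * (2 * M * (n : ℝ) ^ (k - 1)) *
        (((univ : Finset (Fin n)).filter fun v : Fin n => (v : ℕ) * R / n = t).card : ℝ)
      = ((k * k - k : ℕ) : ℝ) * (2 * M * (n : ℝ) ^ (k - 1)) *
        ((((univ : Finset (Fin n)).filter fun v : Fin n => (v : ℕ) * R / n = t).card : ℝ) *
          Fintype.card (Fin m → Fin k → Fin n × Bool)) := by
    rw [sum_const, card_univ, nsmul_eq_mul]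
    ring
  rw [← hΩ, ← sum_add_distrib]
  refine sum_le_sum fun Φ _ => ?_
  -- the numbers at hand
  set U := ((univ : Finset (Fin n)).filter fun w => st (insert i S) (t + 1) Φ w = none).card with hU
  set Nw := ((univ : Finset (Fin n)).filter fun w =>
    st (insert i S) t Φ w = none ∧ st (insert i S) (t + 1) Φ w ≠ none).card with hNw
  set St := ((univ : Finset (Fin n)).filter fun w => st (insert i S) (t + 1) Φ w ≠ none).card with hSt
  have hUS : U + St = n := by
    rw [hU, hSt]
    have := card_filter_add_card_filter_not (s := (univ : Finset (Fin n)))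
      (fun w => st (insert i S) (t + 1) Φ w = none)
    rw [card_univ, Fintype.card_fin] at this
    convert this using 2
  have hM' : (U : ℝ) * (St : ℝ) ^ (k - 2) ≤ M * (n : ℝ) ^ (k - 1) := hM U St hUS
  have hNw' : (Nw : ℝ) ≤ (((univ : Finset (Fin n)).filter fun v : Fin n => (v : ℕ) * R / n = t).card : ℝ) +
      (((univ : Finset (Fin m)).filter fun i' => i' ∉ insert i S ∧ ∃ j : Fin k,
        st (insert i S) t Φ (Φ i' j).1 = none ∧ ∀ j' : Fin k, j' ≠ j →
          st (insert i S) t Φ (Φ i' j').1 ≠ none ∧ st (insert i S) t Φ (Φ i' j').1 ≠ some (Φ i' j').2).card : ℝ) := by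
    rw [hNw]
    exact_mod_cast sissU_card_new_le st dm hstep (insert i S) t Φ
  have hK : (0 : ℝ) ≤ ((k * k - k : ℕ) : ℝ) := Nat.cast_nonneg _
  have hMn : 0 ≤ M * (n : ℝ) ^ (k - 1) := le_trans (by positivity) hM'
  calc ((k * k - k : ℕ) : ℝ) * (((2 * U) * Nw * St ^ (k - 2) : ℕ) : ℝ)
      = ((k * k - k : ℕ) : ℝ) * (2 * ((U : ℝ) * (St : ℝ) ^ (k - 2)) * (Nw : ℝ)) := by push_cast; ring
    _ ≤ ((k * k - k : ℕ) : ℝ) * (2 * (M * (n : ℝ) ^ (k - 1)) * (Nw : ℝ)) := by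
        refine mul_le_mul_of_nonneg_left ?_ hK
        exact mul_le_mul_of_nonneg_right (mul_le_mul_of_nonneg_left hM' (by norm_num)) (Nat.cast_nonneg _)
    _ ≤ ((k * k - k : ℕ) : ℝ) * (2 * (M * (n : ℝ) ^ (k - 1)) *
          ((((univ : Finset (Fin n)).filter fun v : Fin n => (v : ℕ) * R / n = t).card : ℝ) +
            (((univ : Finset (Fin m)).filter fun i' => i' ∉ insert i S ∧ ∃ j : Fin k,
              st (insert i S) t Φ (Φ i' j).1 = none ∧ ∀ j' : Fin k, j' ≠ j →
                st (insert i S) t Φ (Φ i' j').1 ≠ none ∧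
                  st (insert i S) t Φ (Φ i' j').1 ≠ some (Φ i' j').2).card : ℝ))) := by
        refine mul_le_mul_of_nonneg_left ?_ hK
        exact mul_le_mul_of_nonneg_left hNw' (by positivity)
    _ = _ := by ring

/-- **First moment of the number of unit clauses, uniformly in the muting.** Let `k ≥ 2`, and let
`a ≥ 0` satisfy `(k²-k)·2·M·n^{k-1}·m·(W + a) ≤ a·#contents` with `W ≥` every window size (for instance
`W = n/R + 1`).  Then for every round `t` and every muted set `S`: `Σ_Φ N^S_t(Φ) ≤ a·#Ω`. -/
theorem sissU_sum_unit_le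
    (st : Finset (Fin m) → ℕ → (Fin m → Fin k → Fin n × Bool) → Fin n → Option Bool)
    (dm : Finset (Fin m) → ℕ → (Fin m → Fin k → Fin n × Bool) → Fin n → Bool)
    (h0 : ∀ (S : Finset (Fin m)) (Φ : Fin m → Fin k → Fin n × Bool) (v : Fin n), st S 0 Φ v = none)
    (hstep : ∀ (S : Finset (Fin m)) (t : ℕ) (Φ : Fin m → Fin k → Fin n × Bool) (v : Fin n),
      st S (t + 1) Φ v =
        if st S t Φ v = none then
          (if ∃ i : Fin m, i ∉ S ∧ ∃ j : Fin k, (Φ i j).1 = v ∧ ∀ j' : Fin k, j' ≠ j →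
              st S t Φ (Φ i j').1 ≠ none ∧ st S t Φ (Φ i j').1 ≠ some (Φ i j').2
            then some (dm S t Φ v)
            else if (v : ℕ) * R / n = t then some true else none)
        else st S t Φ v)
    (hdm : ∀ (S : Finset (Fin m)) (t : ℕ) (Φ : Fin m → Fin k → Fin n × Bool) (v : Fin n) (i : Fin m)
      (j : Fin k), i ∉ S → (Φ i j).1 = v → st S t Φ v = none →
      (∀ j' : Fin k, j' ≠ j → st S t Φ (Φ i j').1 ≠ none ∧ st S t Φ (Φ i j').1 ≠ some (Φ i j').2) →
      (∀ i' : Fin m, i' ∉ S → (∃ j₁ : Fin k, (Φ i' j₁).1 = v ∧ ∀ j' : Fin k, j' ≠ j₁ →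
        st S t Φ (Φ i' j').1 ≠ none ∧ st S t Φ (Φ i' j').1 ≠ some (Φ i' j').2) → i ≤ i') →
      dm S t Φ v = (Φ i j).2)
    (hk : 2 ≤ k) (hn : 1 ≤ n) (M : ℝ)
    (hM : ∀ u s : ℕ, u + s = n → (u : ℝ) * (s : ℝ) ^ (k - 2) ≤ M * (n : ℝ) ^ (k - 1))
    (W : ℝ) (hW : ∀ t : ℕ, ((((univ : Finset (Fin n)).filter fun v : Fin n => (v : ℕ) * R / n = t).card : ℕ) : ℝ) ≤ W)
    (a : ℝ) (ha : 0 ≤ a)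
    (hfix : ((k * k - k : ℕ) : ℝ) * (2 * M * (n : ℝ) ^ (k - 1)) * (m : ℝ) * (W + a) ≤
      a * Fintype.card (Fin k → Fin n × Bool)) :
    ∀ (t : ℕ) (S : Finset (Fin m)),
      ∑ Φ : Fin m → Fin k → Fin n × Bool,
        (((univ : Finset (Fin m)).filter fun i => i ∉ S ∧ ∃ j : Fin k, st S t Φ (Φ i j).1 = none ∧
          ∀ j' : Fin k, j' ≠ j → st S t Φ (Φ i j').1 ≠ none ∧ st S t Φ (Φ i j').1 ≠ some (Φ i j').2).card : ℝ)
        ≤ a * Fintype.card (Fin m → Fin k → Fin n × Bool) := by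
  intro t
  induction t with
  | zero =>
    intro S
    have hzero : ∀ Φ : Fin m → Fin k → Fin n × Bool,
        (((univ : Finset (Fin m)).filter fun i => i ∉ S ∧ ∃ j : Fin k, st S 0 Φ (Φ i j).1 = none ∧
          ∀ j' : Fin k, j' ≠ j → st S 0 Φ (Φ i j').1 ≠ none ∧ st S 0 Φ (Φ i j').1 ≠ some (Φ i j').2).card : ℝ)
          = 0 := by
      intro Φ
      rw [Nat.cast_eq_zero, card_eq_zero, filter_eq_empty_iff]
      intro i _ hi
      obtain ⟨j, hj, hrest⟩ := hi.2
      exact sissU_not_unit_zero st h0 hk S Φ i (Φ i j).1 ⟨j, rfl, hj, hrest⟩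
    simp only [hzero, sum_const_zero]
    exact mul_nonneg ha (Nat.cast_nonneg _)
  | succ t ih =>
    intro S
    haveI : Nonempty (Fin k → Fin n × Bool) := ⟨fun _ => (⟨0, hn⟩, true)⟩
    have hC : (0 : ℝ) < Fintype.card (Fin k → Fin n × Bool) := by
      exact_mod_cast Fintype.card_pos
    have hW0 : 0 ≤ W := le_trans (Nat.cast_nonneg _) (hW 0)
    have hrec := sissU_sum_unit_succ_le st dm h0 hstep hdm M hM S t
    -- bound the inner sums by the induction hypothesis and the windows by `W`
    have hK : (0 : ℝ) ≤ ((k * k - k : ℕ) : ℝ) * (2 * M * (n : ℝ) ^ (k - 1)) := by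
      have hMn : 0 ≤ M * (n : ℝ) ^ (k - 1) := by
        have := hM 0 n (Nat.zero_add n)
        simp only [Nat.cast_zero, zero_mul] at this
        exact this
      exact mul_nonneg (Nat.cast_nonneg _) (by rw [mul_assoc]; exact mul_nonneg (by norm_num) hMn)
    have hinner : ∀ i : Fin m,
        ((((univ : Finset (Fin n)).filter fun v : Fin n => (v : ℕ) * R / n = t).card : ℝ) *
              Fintype.card (Fin m → Fin k → Fin n × Bool) +
            ∑ Φ : Fin m → Fin k → Fin n × Bool,
              (((univ : Finset (Fin m)).filter fun i' => i' ∉ insert i S ∧ ∃ j : Fin k,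
                st (insert i S) t Φ (Φ i' j).1 = none ∧ ∀ j' : Fin k, j' ≠ j →
                  st (insert i S) t Φ (Φ i' j').1 ≠ none ∧
                    st (insert i S) t Φ (Φ i' j').1 ≠ some (Φ i' j').2).card : ℝ))
          ≤ (W + a) * Fintype.card (Fin m → Fin k → Fin n × Bool) := by
      intro i
      rw [add_mul]
      exact add_le_add (mul_le_mul_of_nonneg_right (hW t) (Nat.cast_nonneg _)) (ih (insert i S))
    have hsum : ∑ i ∈ (univ : Finset (Fin m)).filter (fun i => i ∉ S),
          ((((univ : Finset (Fin n)).filter fun v : Fin n => (v : ℕ) * R / n = t).card : ℝ) *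
              Fintype.card (Fin m → Fin k → Fin n × Bool) +
            ∑ Φ : Fin m → Fin k → Fin n × Bool,
              (((univ : Finset (Fin m)).filter fun i' => i' ∉ insert i S ∧ ∃ j : Fin k,
                st (insert i S) t Φ (Φ i' j).1 = none ∧ ∀ j' : Fin k, j' ≠ j →
                  st (insert i S) t Φ (Φ i' j').1 ≠ none ∧
                    st (insert i S) t Φ (Φ i' j').1 ≠ some (Φ i' j').2).card : ℝ))
          ≤ (m : ℝ) * ((W + a) * Fintype.card (Fin m → Fin k → Fin n × Bool)) := by
      refine (sum_le_sum fun i _ => hinner i).trans ?_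
      rw [sum_const, nsmul_eq_mul]
      refine mul_le_mul_of_nonneg_right ?_ (mul_nonneg (add_nonneg hW0 ha) (Nat.cast_nonneg _))
      exact_mod_cast (card_filter_le _ _).trans (by rw [card_univ, Fintype.card_fin])
    have hfinal := hrec.trans (mul_le_mul_of_nonneg_left hsum hK)
    -- divide by `#contents`
    refine le_of_mul_le_mul_left (hfinal.trans ?_) hC
    have h2 := mul_le_mul_of_nonneg_right hfix (Nat.cast_nonneg (Fintype.card (Fin m → Fin k → Fin n × Bool)))
    calc ((k * k - k : ℕ) : ℝ) * (2 * M * (n : ℝ) ^ (k - 1)) *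
          ((m : ℝ) * ((W + a) * Fintype.card (Fin m → Fin k → Fin n × Bool)))
        = ((k * k - k : ℕ) : ℝ) * (2 * M * (n : ℝ) ^ (k - 1)) * (m : ℝ) * (W + a) *
            Fintype.card (Fin m → Fin k → Fin n × Bool) := by ring
      _ ≤ a * Fintype.card (Fin k → Fin n × Bool) * Fintype.card (Fin m → Fin k → Fin n × Bool) := h2
      _ = _ := by ring

end FirstMoment

end Summit.PneNP.PneNP.Theorems
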